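import Summits.CriticalPhenomena.PercolationContinuityZ3.Theorems.PercAnnulusCrossingIICAnnulusNonUniqueness
import Summits.CriticalPhenomena.PercolationContinuityZ3.Theorems.PercAnnulusCrossingIICLevelDecomposition
import HarnessLib

/-!
# Kesten–Basu–Sapozhnikov IIC scheme in boxes, VI: the junk of one level, with hole and source (lane RSW3, p1 gen 3)

builds on p205010 (kernel theorem, internal audit signed; external expert review pending)

Seat `prim-rsw3-p1` (gen 3); LANE-4 blueprint, memo `run/shared/lean/prim/rsw3/P1-QM.md` §13.4 steps (1)–(2) at every level.  Helper file; no
definitions, no sorries; every `p`, `d`.  Notation as in parts IV–V (`CONN(H,X;n)`, `DAT`, `LINK'`, `EANN`, `CANN`, `NONUNIQ`; all written out).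
* **`real_conn_inter_nonuniq_le_of_setToSetQM`** — under (A2)□(ϰ) (box form, written out), with `a = 2m₁`, `b = 2m₂`, `4m₁ < b`, `4m₂ < n`,
  `X ⊆ Λ(m₁)`, `X ∩ H = ∅`, `H ⊆ Λ(m₁ − 1)`:  `ϰ² · P(CONN(H,X;n) ∩ NONUNIQ(a,b)) ≤ α(a,b) · P(CONN(H,X;n))` — (A2)□ twice (middle spheres
  `∂ⁱⁿΛ(a)` and `∂ⁱⁿΛ(b)`, environment `Z = Λ(n) ∖ H`) recombines the pre-factor, ONE of the two EANN-crossings and the tail into `P(CONN)`;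
  the other EANN-crossing is the price `α(a,b)` (Basu–Sapozhnikov (2.4)/(2.6) with `ε_i ↦ α`, which tends to `0` at `p_c`, part I);
* `link'_of_dat_of_not_nonuniq` — on `DAT(U,R) ∖ NONUNIQ(a,b)` (lattice) the rim is linked inside `U ∖ Λ(a−1)`;
* **`real_conn_diff_good_le`** — `P(E ∩ CONN(H,X;n) ∖ GOOD) ≤ P(CONN(H,X;n) ∩ NONUNIQ(a,b))`, `GOOD = ⋃_{(U,R)} DAT ∩ LINK'`: with part IV's
  exact sum this is the two-sided one-level decomposition `P(E ∩ CONN) − junk ≤ Σ_{(U,R)} P(E ∩ DAT ∩ LINK' ∩ LEFT)·P(CONN(U,R;n)) ≤ P(E ∩ CONN)`.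
References: D. Basu, A. Sapozhnikov, ECP 22 (2017) no. 26, §2 (2.4)–(2.6); G. Grimmett (1999), §2.2.
-/

noncomputable section

namespace Summit.CriticalPhenomena.PercolationContinuityZ3.Theorems.Crossing

open MeasureTheory Literature.Probability.Percolation Literature.Probability.LatticeModels
open Literature.Probability.Percolation.DCT16
open Summit.CriticalPhenomena.PercolationContinuityZ3.Theorems.SurfaceTension
open scoped Literature.Probability.Percolation

variable {d : ℕ}

/-! ## Recombination by (A2)□ -/

/-- **The junk of one level under (A2)□**: see the module docstring. [cite: BasuSapozhnikov2017ECP, §2 eqs. (2.4), (2.6)] -/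
theorem real_conn_inter_nonuniq_le_of_setToSetQM (p : unitInterval) {ϰ : ℝ} (hϰ : 0 ≤ ϰ)
    (hA2 : ∀ m : ℕ, 1 ≤ m → ∀ Z : Finset (Site d), box d (4 * m) \ box d (m - 1) ⊆ Z →
      ∀ X : Finset (Site d), X ⊆ Z ∩ box d m → ∀ Y : Finset (Site d), Y ⊆ Z \ box d (4 * m) →
        ϰ * (bondPercolation (zdGraph d) p).real {ω | ∃ x ∈ X, ∃ s ∈ innerBoundary (zdGraph d) (box d (2 * m)),
              ω ∈ openConnIn (↑Z : Set (Site d)) x s} *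
          (bondPercolation (zdGraph d) p).real {ω | ∃ y ∈ Y, ∃ s ∈ innerBoundary (zdGraph d) (box d (2 * m)),
              ω ∈ openConnIn (↑Z : Set (Site d)) y s} ≤
        (bondPercolation (zdGraph d) p).real {ω | ∃ x ∈ X, ∃ y ∈ Y, ω ∈ openConnIn (↑Z : Set (Site d)) x y})
    {m₁ m₂ n : ℕ} (hm₁ : 1 ≤ m₁) (h12 : 4 * m₁ < 2 * m₂) (hn : 4 * m₂ < n)
    {H X : Finset (Site d)} (hH : H ⊆ box d (m₁ - 1)) (hX : X ⊆ box d m₁) (hXH : ∀ x ∈ X, x ∉ H) :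
    ϰ ^ 2 * (bondPercolation (zdGraph d) p).real
        ({ω : BondConfig (Site d) | ∃ x ∈ X, ∃ t ∈ innerBoundary (zdGraph d) (box d n),
            ω ∈ openConnIn ((↑(box d n) : Set (Site d)) \ ↑H) x t} ∩
         {ω : BondConfig (Site d) | ∃ t₁ ∈ innerBoundary (zdGraph d) (box d (2 * m₁)), ∃ w₁ ∈ innerBoundary (zdGraph d) (box d (2 * m₂)),
            ∃ t₂ ∈ innerBoundary (zdGraph d) (box d (2 * m₁)), ∃ w₂ ∈ innerBoundary (zdGraph d) (box d (2 * m₂)),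
            ω ∩ {e : Sym2 (Site d) | e ∈ (↑((box d (2 * m₂)).sym2) : Set (Sym2 (Site d))) ∧
                ¬ (∀ v ∈ e, v ∈ box d (2 * m₁)) ∧ ¬ (∀ v ∈ e, v ∈ innerBoundary (zdGraph d) (box d (2 * m₂)))} ∈
              openConnIn (↑(box d (2 * m₂)) : Set (Site d)) t₁ w₁ ∧
            ω ∩ {e : Sym2 (Site d) | e ∈ (↑((box d (2 * m₂)).sym2) : Set (Sym2 (Site d))) ∧
                ¬ (∀ v ∈ e, v ∈ box d (2 * m₁)) ∧ ¬ (∀ v ∈ e, v ∈ innerBoundary (zdGraph d) (box d (2 * m₂)))} ∈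
              openConnIn (↑(box d (2 * m₂)) : Set (Site d)) t₂ w₂ ∧
            ω ∩ {e : Sym2 (Site d) | e ∈ (↑((box d (2 * m₂)).sym2) : Set (Sym2 (Site d))) ∧
                ¬ (∀ v ∈ e, v ∈ box d (2 * m₁)) ∧ ¬ (∀ v ∈ e, v ∈ innerBoundary (zdGraph d) (box d (2 * m₂)))} ∉
              openConnIn (↑(box d (2 * m₂)) : Set (Site d)) w₁ w₂}) ≤
      (bondPercolation (zdGraph d) p).real (boxCrossing d (2 * m₁) (2 * m₂)) *
        (bondPercolation (zdGraph d) p).real {ω : BondConfig (Site d) | ∃ x ∈ X, ∃ t ∈ innerBoundary (zdGraph d) (box d n),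
            ω ∈ openConnIn ((↑(box d n) : Set (Site d)) \ ↑H) x t} := by
  classical
  set μ := bondPercolation (zdGraph d) p with hμ
  set a := 2 * m₁ with ha
  set b := 2 * m₂ with hb
  have ha1 : 1 ≤ a := by omega
  have hab : a ≤ b - 1 := by omega
  have hbn : b ≤ n := by omega
  have hHa : H ⊆ box d (a - 1) := hH.trans (box_mono d (by omega))
  have hXa : X ⊆ box d a := hX.trans (box_mono d (by omega))
  set Z : Finset (Site d) := box d n \ H with hZ
  have hZcoe : (↑Z : Set (Site d)) = (↑(box d n) : Set (Site d)) \ ↑H := by rw [hZ, Finset.coe_sdiff]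
  set EANN : Set (Sym2 (Site d)) := {e : Sym2 (Site d) | e ∈ (↑((box d b).sym2) : Set (Sym2 (Site d))) ∧
    ¬ (∀ v ∈ e, v ∈ box d a) ∧ ¬ (∀ v ∈ e, v ∈ innerBoundary (zdGraph d) (box d b))} with hEANN
  set CONN := {ω : BondConfig (Site d) | ∃ x ∈ X, ∃ t ∈ innerBoundary (zdGraph d) (box d n),
    ω ∈ openConnIn ((↑(box d n) : Set (Site d)) \ ↑H) x t} with hCONN
  set PRE := {ω : BondConfig (Site d) | ∃ x ∈ X, ∃ s ∈ innerBoundary (zdGraph d) (box d a),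
    ω ∈ openConnIn ((↑(box d a) : Set (Site d)) \ ↑H) x s} with hPRE
  set CANN := {ω : BondConfig (Site d) | ∃ t ∈ innerBoundary (zdGraph d) (box d a), ∃ w ∈ innerBoundary (zdGraph d) (box d b),
    ω ∩ EANN ∈ openConnIn (↑(box d b) : Set (Site d)) t w} with hCANN
  set NU := {ω : BondConfig (Site d) | ∃ t₁ ∈ innerBoundary (zdGraph d) (box d a), ∃ w₁ ∈ innerBoundary (zdGraph d) (box d b),
    ∃ t₂ ∈ innerBoundary (zdGraph d) (box d a), ∃ w₂ ∈ innerBoundary (zdGraph d) (box d b),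
    ω ∩ EANN ∈ openConnIn (↑(box d b) : Set (Site d)) t₁ w₁ ∧ ω ∩ EANN ∈ openConnIn (↑(box d b) : Set (Site d)) t₂ w₂ ∧
    ω ∩ EANN ∉ openConnIn (↑(box d b) : Set (Site d)) w₁ w₂} with hNU
  set TAIL := {ω : BondConfig (Site d) | ∃ s ∈ innerBoundary (zdGraph d) (box d b),
    ∃ t ∈ innerBoundary (zdGraph d) (box d n), ω ∈ openConnIn ((↑(box d n) : Set (Site d)) \ ↑(box d (b - 1))) s t} with hTAIL
  -- the link events of (A2)□ in `Z`
  set LXa := μ.real {ω | ∃ x ∈ X, ∃ s ∈ innerBoundary (zdGraph d) (box d (2 * m₁)), ω ∈ openConnIn (↑Z : Set (Site d)) x s} with hLXa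
  set LBa := μ.real {ω | ∃ y ∈ innerBoundary (zdGraph d) (box d b), ∃ s ∈ innerBoundary (zdGraph d) (box d (2 * m₁)),
    ω ∈ openConnIn (↑Z : Set (Site d)) y s} with hLBa
  set LXb := μ.real {ω | ∃ x ∈ X, ∃ y ∈ innerBoundary (zdGraph d) (box d b), ω ∈ openConnIn (↑Z : Set (Site d)) x y} with hLXb
  set LXb' := μ.real {ω | ∃ x ∈ X, ∃ s ∈ innerBoundary (zdGraph d) (box d (2 * m₂)), ω ∈ openConnIn (↑Z : Set (Site d)) x s} with hLXb'
  set LNb := μ.real {ω | ∃ y ∈ innerBoundary (zdGraph d) (box d n), ∃ s ∈ innerBoundary (zdGraph d) (box d (2 * m₂)),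
    ω ∈ openConnIn (↑Z : Set (Site d)) y s} with hLNb
  set LXn := μ.real {ω | ∃ x ∈ X, ∃ y ∈ innerBoundary (zdGraph d) (box d n), ω ∈ openConnIn (↑Z : Set (Site d)) x y} with hLXn
  -- (A2)□ #1 at scale `m₁`, `Y = ∂ⁱⁿΛ(b)`
  have hZ1 : box d (4 * m₁) \ box d (m₁ - 1) ⊆ Z := by
    intro z hz
    rw [Finset.mem_sdiff] at hz ⊢
    exact ⟨box_mono d (by omega) hz.1, fun h => hz.2 (hH h)⟩
  have hX1 : X ⊆ Z ∩ box d m₁ := fun x hx =>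
    Finset.mem_inter.2 ⟨Finset.mem_sdiff.2 ⟨box_mono d (by omega) (hX hx), hXH x hx⟩, hX hx⟩
  have hY1 : innerBoundary (zdGraph d) (box d b) ⊆ Z \ box d (4 * m₁) := by
    intro y hy
    have hyb : y ∈ box d b := (Finset.mem_filter.1 hy).1
    have hyb1 : y ∉ box d (b - 1) := notMem_box_of_mem_innerBoundary_box (by omega) hy
    refine Finset.mem_sdiff.2 ⟨Finset.mem_sdiff.2 ⟨box_mono d hbn hyb, fun h => hyb1 (box_mono d (by omega) (hH h))⟩,
      fun h => hyb1 (box_mono d (by omega) h)⟩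
  have key1 : ϰ * LXa * LBa ≤ LXb := hA2 m₁ hm₁ Z hZ1 X hX1 _ hY1
  -- (A2)□ #2 at scale `m₂`, `Y = ∂ⁱⁿΛ(n)`
  have hZ2 : box d (4 * m₂) \ box d (m₂ - 1) ⊆ Z := by
    intro z hz
    rw [Finset.mem_sdiff] at hz ⊢
    exact ⟨box_mono d hn.le hz.1, fun h => hz.2 (box_mono d (by omega) (hH h))⟩
  have hX2 : X ⊆ Z ∩ box d m₂ := fun x hx =>
    Finset.mem_inter.2 ⟨Finset.mem_sdiff.2 ⟨box_mono d (by omega) (hX hx), hXH x hx⟩, box_mono d (by omega) (hX hx)⟩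
  have hY2 : innerBoundary (zdGraph d) (box d n) ⊆ Z \ box d (4 * m₂) := by
    intro y hy
    have hyn : y ∈ box d n := (Finset.mem_filter.1 hy).1
    have hyn1 : y ∉ box d (n - 1) := notMem_box_of_mem_innerBoundary_box (by omega) hy
    refine Finset.mem_sdiff.2 ⟨Finset.mem_sdiff.2 ⟨hyn, fun h => hyn1 (box_mono d (by omega) (hH h))⟩,
      fun h => hyn1 (box_mono d (by omega) h)⟩
  have key2 : ϰ * LXb' * LNb ≤ LXn := hA2 m₂ (by omega) Z hZ2 X hX2 _ hY2
  -- identifications / comparisons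
  have e0 : LXb = LXb' := by rw [hLXb, hLXb']
  have e1 : μ.real PRE ≤ LXa := by
    refine measureReal_mono (fun ω hω => ?_) (measure_ne_top _ _)
    obtain ⟨x, hx, s, hs, h⟩ := hω
    refine ⟨x, hx, s, hs, openConnIn_mono ?_ _ _ h⟩
    rw [hZcoe]; exact fun z hz => ⟨Finset.mem_coe.2 (box_mono d (by omega) (Finset.mem_coe.1 hz.1)), hz.2⟩
  have e2 : μ.real CANN ≤ LBa := by
    refine real_mono_of_forall_subset_edgeSet (zdGraph d) p fun ω hω h => ?_
    obtain ⟨t, ht, w, hw, htw⟩ := h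
    have hωE : ω ∩ EANN ⊆ (zdGraph d).edgeSet := fun e he => hω he.1
    obtain ⟨q, hqS, hqE⟩ := exists_walk_of_mem_openConnIn hωE htw
    have hta1 : t ∉ box d (a - 1) := notMem_box_of_mem_innerBoundary_box (by omega) ht
    have hsupp := notMem_box_pred_of_eann_walk (a := a) (b := b) ha1 q (fun e he => (hqE e he).2) hta1
    refine ⟨w, hw, t, ht, ?_⟩
    rw [openConnIn_comm]
    refine mem_openConnIn_of_walk q (fun z hz => ?_) (fun e he => (hqE e he).1)
    rw [hZcoe]
    exact ⟨Finset.mem_coe.2 (box_mono d hbn (Finset.mem_coe.1 (hqS z hz))), fun h => hsupp z hz (hHa (Finset.mem_coe.1 h))⟩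
  have e3 : μ.real TAIL ≤ LNb := by
    refine measureReal_mono (fun ω hω => ?_) (measure_ne_top _ _)
    obtain ⟨s, hs, t, ht, h⟩ := hω
    refine ⟨t, ht, s, hs, ?_⟩
    rw [openConnIn_comm]
    refine openConnIn_mono ?_ _ _ h
    rw [hZcoe]; exact fun z hz => ⟨hz.1, fun h' => hz.2 (Finset.mem_coe.2 (box_mono d (by omega) (hH (Finset.mem_coe.1 h'))))⟩
  have e4 : LXn = μ.real CONN := by rw [hLXn, hCONN, hZcoe]
  -- assemble
  have h3 := real_conn_inter_nonuniq_le_mul3 (d := d) p ha1 hab hbn hHa hXa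
  have hNU := real_nonuniq_le_sq (d := d) p a b
  have hC := real_cann_le_boxCrossing (d := d) p (by omega : a ≤ b)
  have hPRE0 : 0 ≤ μ.real PRE := measureReal_nonneg
  have hTAIL0 : 0 ≤ μ.real TAIL := measureReal_nonneg
  have hCANN0 : 0 ≤ μ.real CANN := measureReal_nonneg
  have hLBa0 : 0 ≤ LBa := measureReal_nonneg
  have hLNb0 : 0 ≤ LNb := measureReal_nonneg
  calc ϰ ^ 2 * μ.real (CONN ∩ NU) ≤ ϰ ^ 2 * (μ.real PRE * μ.real NU * μ.real TAIL) :=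
        mul_le_mul_of_nonneg_left h3 (pow_nonneg hϰ 2)
    _ ≤ ϰ ^ 2 * (μ.real PRE * (μ.real CANN * μ.real CANN) * μ.real TAIL) := by
        refine mul_le_mul_of_nonneg_left ?_ (pow_nonneg hϰ 2)
        refine mul_le_mul_of_nonneg_right (mul_le_mul_of_nonneg_left ?_ hPRE0) hTAIL0
        rw [← sq]; exact hNU
    _ = μ.real CANN * (ϰ * (ϰ * μ.real PRE * μ.real CANN) * μ.real TAIL) := by ring
    _ ≤ μ.real CANN * (ϰ * (ϰ * LXa * LBa) * LNb) := by
        refine mul_le_mul_of_nonneg_left ?_ hCANN0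
        refine mul_le_mul ?_ e3 hTAIL0 ?_
        · exact mul_le_mul_of_nonneg_left (mul_le_mul (mul_le_mul_of_nonneg_left e1 hϰ) e2 hCANN0
            (mul_nonneg hϰ measureReal_nonneg)) hϰ
        · exact mul_nonneg hϰ (mul_nonneg (mul_nonneg hϰ measureReal_nonneg) hLBa0)
    _ ≤ μ.real CANN * (ϰ * LXb' * LNb) := by
        refine mul_le_mul_of_nonneg_left (mul_le_mul_of_nonneg_right ?_ hLNb0) hCANN0
        rw [← e0]; exact mul_le_mul_of_nonneg_left key1 hϰ
    _ ≤ μ.real CANN * μ.real CONN := by rw [← e4]; exact mul_le_mul_of_nonneg_left key2 hCANN0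
    _ ≤ μ.real (boxCrossing d a b) * μ.real CONN := mul_le_mul_of_nonneg_right hC measureReal_nonneg

/-! ## No non-uniqueness ⇒ the rim is linked inside `U ∖ Λ(a−1)` -/

/-- On the datum (lattice, `1 ≤ a ≤ b − 1`, `U ⊆ Λ(b)`): every rim vertex `r` hangs off some `v ∈ U ∩ ∂ⁱⁿΛ(b)` which is joined inside
`U ∖ Λ(a−1)` to the outer end `w ∈ ∂ⁱⁿΛ(b)` of an EANN-crossing from `∂ⁱⁿΛ(a)` (cut an exploring path at its last exit from `Λ(a)` and at its
first arrival on `∂ⁱⁿΛ(b)`). [cite: BasuSapozhnikov2017ECP, §2 (F_i)] -/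
theorem exists_eann_crossing_of_rim {a b : ℕ} (ha : 1 ≤ a) (hab : a ≤ b - 1) {U R : Finset (Site d)} (hUb : U ⊆ box d b)
    {ω : BondConfig (Site d)} (hω : ω ⊆ (zdGraph d).edgeSet)
    (hD : ω ∩ (↑((box d (b + 1)).sym2) : Set (Sym2 (Site d))) ∈
      explEvent (↑(box d a) : Set (Site d)) ((↑(box d b) : Set (Site d)) \ ↑(box d a)) ↑U ↑R) {r : Site d} (hr : r ∈ R) :
    ∃ v ∈ U, s(v, r) ∈ ω ∧ ∃ t ∈ innerBoundary (zdGraph d) (box d a), ∃ w ∈ innerBoundary (zdGraph d) (box d b),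
      ω ∩ {e : Sym2 (Site d) | e ∈ (↑((box d b).sym2) : Set (Sym2 (Site d))) ∧
          ¬ (∀ v ∈ e, v ∈ box d a) ∧ ¬ (∀ v ∈ e, v ∈ innerBoundary (zdGraph d) (box d b))} ∈
        openConnIn (↑(box d b) : Set (Site d)) t w ∧
      ω ∈ openConnIn ((↑U : Set (Site d)) \ ↑(box d (a - 1))) w v := by
  classical
  have hab' : a ≤ b := by omega
  have hD' := (mem_dat_iff_mem_explEvent (a := a) (R := R) hUb hω).1 hD
  obtain ⟨hSet, hRim⟩ := mem_explEvent_iff.1 hD'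
  have hIB : (↑(box d a) : Set (Site d)) ∪ ((↑(box d b) : Set (Site d)) \ ↑(box d a)) = ↑(box d b) := coe_box_union_sdiff hab'
  have hr' : r ∈ explRim (↑(box d a) : Set (Site d)) ((↑(box d b) : Set (Site d)) \ ↑(box d a)) ω := by
    rw [hRim]; exact Finset.mem_coe.2 hr
  obtain ⟨-, v, hv, hvr⟩ := mem_explRim_iff.1 hr'
  have hrb : r ∉ box d b := fun h => explRim_disjoint hr' (by rw [hIB]; exact Finset.mem_coe.2 h)
  obtain ⟨hvIB, u, hu, huv⟩ := mem_explSet_iff_exists.1 hv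
  rw [hIB] at hvIB huv
  have hvB : v ∈ innerBoundary (zdGraph d) (box d b) :=
    mem_innerBoundary_iff.2 ⟨Finset.mem_coe.1 hvIB, r, hrb, by have := hω hvr; rwa [SimpleGraph.mem_edgeSet] at this⟩
  have hvU : v ∈ U := by rw [hSet] at hv; exact Finset.mem_coe.1 hv
  -- every vertex joined to `u` inside `Λ(b)` is explored
  have hexpl : ∀ z : Site d, ω ∈ openConnIn (↑(box d b) : Set (Site d)) u z → z ∈ (↑U : Set (Site d)) := by
    intro z huz
    rw [← hSet]
    exact mem_explSet_of_openConnIn (subset_explSet _ _ ω hu) (by rw [hIB]; exact huz)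
  -- the exploring walk `u → v`; last exit from `Λ(a)` (= first exit of the reversed walk from `Λ(a)ᶜ`)
  obtain ⟨P, hPS, hPω⟩ := exists_walk_of_mem_openConnIn hω huv
  have hva : v ∉ box d a := notMem_box_of_mem_innerBoundary_box (by omega) hvB
  obtain ⟨a₂, t, q, rest, hadj₂, ha₂, ht, hqB, hqP, hrestP, hedges⟩ :=
    exists_cut_walk_edge ((↑(box d a) : Set (Site d))ᶜ) P.reverse hva (fun h => h (Finset.mem_coe.2 (Finset.mem_coe.1 (Finset.mem_coe.2 hu))))
  have hta : t ∈ box d a := by by_contra h; exact ht (fun h' => h (Finset.mem_coe.1 h'))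
  have htB : t ∈ innerBoundary (zdGraph d) (box d a) := mem_innerBoundary_iff.2 ⟨hta, a₂, fun h => ha₂ (Finset.mem_coe.2 h), hadj₂.symm⟩
  have hPrevω : ∀ e ∈ P.reverse.edges, e ∈ ω := fun e he => by
    rw [SimpleGraph.Walk.edges_reverse, List.mem_reverse] at he; exact hPω e he
  have hPrevS : ∀ z ∈ P.reverse.support, z ∈ (↑(box d b) : Set (Site d)) := fun z hz => by
    rw [SimpleGraph.Walk.support_reverse, List.mem_reverse] at hz; exact hPS z hz
  -- all vertices of `P` are explored and connected
  have hPU : ∀ z ∈ P.reverse.support, z ∈ (↑U : Set (Site d)) := fun z hz => by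
    rw [SimpleGraph.Walk.support_reverse, List.mem_reverse] at hz
    exact hexpl z (mem_openConnIn_of_mem_support P hPS hPω hz)
  -- the walk `W : t → v`, `W = (t, a₂) · q.reverse`
  set W : (zdGraph d).Walk t v := SimpleGraph.Walk.cons hadj₂.symm q.reverse with hW
  have hWedges : ∀ e ∈ W.edges, e ∈ ω := by
    intro e he
    rw [hW, SimpleGraph.Walk.edges_cons, List.mem_cons, SimpleGraph.Walk.edges_reverse, List.mem_reverse] at he
    rcases he with rfl | he
    · apply hPrevω; rw [hedges, Sym2.eq_swap]; exact List.mem_append_right _ List.mem_cons_self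
    · apply hPrevω; rw [hedges]; exact List.mem_append_left _ he
  have hWsupp : ∀ z ∈ W.support, z = t ∨ z ∈ q.support := by
    intro z hz
    rw [hW, SimpleGraph.Walk.support_cons, List.mem_cons, SimpleGraph.Walk.support_reverse, List.mem_reverse] at hz
    exact hz
  have hWb : ∀ z ∈ W.support, z ∈ (↑(box d b) : Set (Site d)) := fun z hz =>
    (hWsupp z hz).elim (fun h => h ▸ Finset.mem_coe.2 (box_mono d hab' hta)) (fun h => hPrevS z (hqP z h))
  have hWU : ∀ z ∈ W.support, z ∈ (↑U : Set (Site d)) \ ↑(box d (a - 1)) := by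
    intro z hz
    rcases hWsupp z hz with rfl | hzq
    · refine ⟨hPU z (hrestP z rest.start_mem_support), fun h => ?_⟩
      exact notMem_box_of_mem_innerBoundary_box (by omega : a - 1 < a) htB (Finset.mem_coe.1 h)
    · exact ⟨hPU z (hqP z hzq), fun h => hqB z hzq (Finset.mem_coe.2 (box_mono d (Nat.sub_le a 1) (Finset.mem_coe.1 h)))⟩
  have hWnotA : ∀ e ∈ W.edges, ¬ (∀ x ∈ e, x ∈ box d a) := by
    intro e he hall
    rw [hW, SimpleGraph.Walk.edges_cons, List.mem_cons, SimpleGraph.Walk.edges_reverse, List.mem_reverse] at he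
    rcases he with rfl | he
    · exact ha₂ (Finset.mem_coe.2 (hall a₂ (Sym2.mem_mk_right _ _)))
    · induction e using Sym2.ind with
      | h x y => exact hqB x (q.fst_mem_support_of_mem_edges he) (Finset.mem_coe.2 (hall x (Sym2.mem_mk_left x y)))
  -- first arrival of `W` on `∂ⁱⁿΛ(b)`
  have htNB : t ∈ (↑(innerBoundary (zdGraph d) (box d b)) : Set (Site d))ᶜ := fun h =>
    notMem_box_of_mem_innerBoundary_box (by omega : b - 1 < b) (Finset.mem_coe.1 h) (box_mono d hab hta)
  have hvNB : v ∉ (↑(innerBoundary (zdGraph d) (box d b)) : Set (Site d))ᶜ := fun h => h (Finset.mem_coe.2 hvB)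
  obtain ⟨a₃, w, q₃, r₃, hadj₃, ha₃, hw, hq₃B, hq₃W, hr₃W, hedges₃⟩ :=
    exists_cut_walk_edge ((↑(innerBoundary (zdGraph d) (box d b)) : Set (Site d))ᶜ) W htNB hvNB
  have hwB : w ∈ innerBoundary (zdGraph d) (box d b) := by by_contra h; exact hw (fun h' => h (Finset.mem_coe.1 h'))
  have hq₃e : ∀ e ∈ q₃.edges, e ∈ W.edges := fun e he => by rw [hedges₃]; exact List.mem_append_left _ he
  have he₃ : s(a₃, w) ∈ W.edges := by rw [hedges₃]; exact List.mem_append_right _ List.mem_cons_self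
  have hr₃e : ∀ e ∈ r₃.edges, e ∈ W.edges := fun e he => by rw [hedges₃]; exact List.mem_append_right _ (List.mem_cons_of_mem _ he)
  refine ⟨v, hvU, hvr, t, htB, w, hwB, ?_, ?_⟩
  · -- the EANN-crossing `q₃ · (a₃, w)`
    refine mem_openConnIn_of_walk (q₃.concat hadj₃) (fun z hz => ?_) (fun e he => ?_)
    · rw [SimpleGraph.Walk.support_concat, List.mem_append, List.mem_singleton] at hz
      rcases hz with hz | rfl
      · exact hWb z (hq₃W z hz)
      · exact Finset.mem_coe.2 (Finset.mem_filter.1 hwB).1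
    · rw [SimpleGraph.Walk.edges_concat, List.concat_eq_append, List.mem_append, List.mem_singleton] at he
      have heW : e ∈ W.edges := he.elim (hq₃e e) (fun h => h ▸ he₃)
      refine ⟨hWedges e heW, ?_, hWnotA e heW, ?_⟩
      · -- a pair of `Λ(b)`
        induction e using Sym2.ind with
        | h x y =>
          rw [Finset.coe_sym2, Set.mk_mem_sym2_iff]
          exact ⟨hWb x (W.fst_mem_support_of_mem_edges heW), hWb y (W.snd_mem_support_of_mem_edges heW)⟩
      · -- not inside the outer layer: an endpoint lies in `q₃.support ⊆ (∂ⁱⁿΛ(b))ᶜ`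
        intro hall
        rcases he with he | rfl
        · induction e using Sym2.ind with
          | h x y => exact hq₃B x (q₃.fst_mem_support_of_mem_edges he) (Finset.mem_coe.2 (hall x (Sym2.mem_mk_left x y)))
        · exact ha₃ (Finset.mem_coe.2 (hall a₃ (Sym2.mem_mk_left _ _)))
  · -- `w ↔ v` inside `U ∖ Λ(a−1)` along `r₃`
    exact mem_openConnIn_of_walk r₃ (fun z hz => hWU z (hr₃W z hz)) (fun e he => hWedges e (hr₃e e he))

/-- **`DAT(U,R) ∖ NONUNIQ(a,b) ⊆ LINK'(U,R)`** on lattice configurations (`1 ≤ a ≤ b − 1`, `U ⊆ Λ(b)`): the EANN-crossings attached to two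
rim vertices are EANN-joined (no non-uniqueness), and an open EANN-path from an explored vertex stays explored and avoids `Λ(a−1)`.
[cite: BasuSapozhnikov2017ECP, §2 (F_i)] -/
theorem link'_of_dat_of_not_nonuniq {a b : ℕ} (ha : 1 ≤ a) (hab : a ≤ b - 1) {U R : Finset (Site d)} (hUb : U ⊆ box d b)
    {ω : BondConfig (Site d)} (hω : ω ⊆ (zdGraph d).edgeSet)
    (hD : ω ∩ (↑((box d (b + 1)).sym2) : Set (Sym2 (Site d))) ∈
      explEvent (↑(box d a) : Set (Site d)) ((↑(box d b) : Set (Site d)) \ ↑(box d a)) ↑U ↑R)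
    (hN : ω ∉ {ω : BondConfig (Site d) | ∃ t₁ ∈ innerBoundary (zdGraph d) (box d a), ∃ w₁ ∈ innerBoundary (zdGraph d) (box d b),
        ∃ t₂ ∈ innerBoundary (zdGraph d) (box d a), ∃ w₂ ∈ innerBoundary (zdGraph d) (box d b),
        ω ∩ {e : Sym2 (Site d) | e ∈ (↑((box d b).sym2) : Set (Sym2 (Site d))) ∧
            ¬ (∀ v ∈ e, v ∈ box d a) ∧ ¬ (∀ v ∈ e, v ∈ innerBoundary (zdGraph d) (box d b))} ∈
          openConnIn (↑(box d b) : Set (Site d)) t₁ w₁ ∧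
        ω ∩ {e : Sym2 (Site d) | e ∈ (↑((box d b).sym2) : Set (Sym2 (Site d))) ∧
            ¬ (∀ v ∈ e, v ∈ box d a) ∧ ¬ (∀ v ∈ e, v ∈ innerBoundary (zdGraph d) (box d b))} ∈
          openConnIn (↑(box d b) : Set (Site d)) t₂ w₂ ∧
        ω ∩ {e : Sym2 (Site d) | e ∈ (↑((box d b).sym2) : Set (Sym2 (Site d))) ∧
            ¬ (∀ v ∈ e, v ∈ box d a) ∧ ¬ (∀ v ∈ e, v ∈ innerBoundary (zdGraph d) (box d b))} ∉
          openConnIn (↑(box d b) : Set (Site d)) w₁ w₂}) :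
    ω ∈ {ω : BondConfig (Site d) | ∀ r ∈ R, ∀ r' ∈ R, ∃ v ∈ U, ∃ v' ∈ U,
      s(v, r) ∈ ω ∧ s(v', r') ∈ ω ∧ ω ∈ openConnIn ((↑U : Set (Site d)) \ ↑(box d (a - 1))) v v'} := by
  classical
  have hab' : a ≤ b := by omega
  have hD' := (mem_dat_iff_mem_explEvent (a := a) (R := R) hUb hω).1 hD
  obtain ⟨hSet, -⟩ := mem_explEvent_iff.1 hD'
  have hIB : (↑(box d a) : Set (Site d)) ∪ ((↑(box d b) : Set (Site d)) \ ↑(box d a)) = ↑(box d b) := coe_box_union_sdiff hab'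
  intro r hr r' hr'
  obtain ⟨v, hv, hvr, t, ht, w, hw, hcross, hwv⟩ := exists_eann_crossing_of_rim ha hab hUb hω hD hr
  obtain ⟨v', hv', hv'r', t', ht', w', hw', hcross', hw'v'⟩ := exists_eann_crossing_of_rim ha hab hUb hω hD hr'
  refine ⟨v, hv, v', hv', hvr, hv'r', ?_⟩
  -- the two crossings are EANN-joined
  have hjoin : ω ∩ {e : Sym2 (Site d) | e ∈ (↑((box d b).sym2) : Set (Sym2 (Site d))) ∧
      ¬ (∀ v ∈ e, v ∈ box d a) ∧ ¬ (∀ v ∈ e, v ∈ innerBoundary (zdGraph d) (box d b))} ∈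
      openConnIn (↑(box d b) : Set (Site d)) w w' := by
    by_contra h
    exact hN ⟨t, ht, w, hw, t', ht', w', hw', hcross, hcross', h⟩
  have hωE : ω ∩ {e : Sym2 (Site d) | e ∈ (↑((box d b).sym2) : Set (Sym2 (Site d))) ∧
      ¬ (∀ v ∈ e, v ∈ box d a) ∧ ¬ (∀ v ∈ e, v ∈ innerBoundary (zdGraph d) (box d b))} ⊆ (zdGraph d).edgeSet :=
    fun e he => hω he.1
  obtain ⟨J, hJS, hJE⟩ := exists_walk_of_mem_openConnIn hωE hjoin
  have hwa1 : w ∉ box d (a - 1) := fun h => notMem_box_of_mem_innerBoundary_box (by omega : a - 1 < b) hw h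
  have hJavoid := notMem_box_pred_of_eann_walk (a := a) (b := b) ha J (fun e he => (hJE e he).2) hwa1
  -- `w` is explored, hence so is every vertex of `J`
  have hwU' : w ∈ explSet (↑(box d a) : Set (Site d)) ((↑(box d b) : Set (Site d)) \ ↑(box d a)) ω := by
    rw [hSet]; exact hwv.1.1
  have hJU : ∀ z ∈ J.support, z ∈ (↑U : Set (Site d)) \ ↑(box d (a - 1)) := by
    intro z hz
    refine ⟨?_, fun h => hJavoid z hz (Finset.mem_coe.1 h)⟩
    rw [← hSet]
    refine mem_explSet_of_openConnIn hwU' ?_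
    rw [hIB]
    exact isUpperSet_openConnIn _ w z Set.inter_subset_left (mem_openConnIn_of_mem_support J hJS hJE hz)
  have hww' : ω ∈ openConnIn ((↑U : Set (Site d)) \ ↑(box d (a - 1))) w w' :=
    mem_openConnIn_of_walk J hJU (fun e he => (hJE e he).1)
  rw [openConnIn_comm] at hwv
  exact PlanarDuality.openConnIn_trans (PlanarDuality.openConnIn_trans hwv hww') hw'v'

end Summit.CriticalPhenomena.PercolationContinuityZ3.Theorems.Crossing

end
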